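import Literature.NumberTheory.LFunctions.RiemannXiPrimitive
import Literature.NumberTheory.LFunctions.HuxleyLargeValuesProofs
import Literature.Analysis.SpecialFunctions.GammaVerticalBoundsSharp
import Literature.Analysis.SpecialFunctions.GammaStirlingOrder
import Mathlib.Analysis.Complex.ReImTopology
import HarnessLib

/-!
# Lagarias–Montague 2011, Lemma 3.3 (1): decay of `ξ` on `1/2 ≤ Re s ≤ 2` — proof

Proof file (companion of `RiemannXiPrimitive.lean`, which it imports) discharging the NAMED FACT
`Literature.NumberTheory.LFunctions.norm_riemannXi_le_of_mem_strip_LM`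
[LagariasMontague2011, Lemma 3.3 (1); arXiv:1106.4348 pp. 8–9]: there is `C₁ > 0` with
`|ξ(s)| ≤ C₁ e^{−π|t|/4} (|t| + 1)^{5/2}` for `1/2 ≤ Re s ≤ 2` (`t = Im s`).

We follow the printed proof ("`|½ s(s−1)| = O(|t|²)`, `|π^{−s/2}| = O(1)`, Stirling for `Γ(s/2)`,
convexity for `ζ`, combine") with the exponents made honest. The printed line
"`|Γ(s/2)| = O(e^{−π|t|/4})`" is only true for `Re s ≤ 1`; at `Re s = 2` one has
`|Γ(1 + it/2)| ≍ |t|^{1/2} e^{−π|t|/4}` and the exponent `5/2` of the Lemma is then SHARP, so the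
two factors must be balanced:

* `Γ`: `‖Γ(x + iy)‖ ≤ K_Γ |y|^{x − 1/2} e^{−π|y|/2}` for `−1/2 ≤ x ≤ 1`, `|y| ≥ 2`
  (`LagariasMontague.norm_Gamma_le_rpow_mul_exp`), from the tree's sharp functional-equation factor
  bound `Literature.Analysis.SpecialFunctions.GammaVert.norm_fe_factor_le_sharp` at `x + 1`,
  `‖cos(π s'/2)‖ ≥ sinh(π|y|/2) ≥ e^{π|y|/2}/4` and `Γ(z + 1) = z Γ(z)`; hence
  `‖Γ(s/2)‖ ≤ 2K_Γ |t|^{(σ−1)/2} e^{−π|t|/4}` on the strip for `|t| ≥ 4`;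
* `ζ`: `|t|^{(σ−1)/2} ‖ζ(s)‖ ≤ 84 |t|^{1/2}` for `1/2 ≤ σ ≤ 2`, `|t| ≥ 3`, from the tree's
  `‖ζ‖ ≤ 10|t|^{1−σ}(1 + log|t|)` on `1/2 ≤ σ ≤ 1` (`HuxleyLV.norm_zeta_le_rpow_log`, Titchmarsh
  (3.5.3)), `‖ζ‖ ≤ 21 log|t|` on `σ ≥ 1` (`ZetaOneLine.norm_riemannZeta_le_log`, Titchmarsh Thm. 3.5)
  used on `1 ≤ σ ≤ 3/2`, and `‖ζ‖ ≤ σ/(σ−1) ≤ 3` on `σ ≥ 3/2`;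
* `|t| ≤ 6`: `ξ` is entire, hence bounded on the compact rectangle `[1/2, 2] × [−6, 6]`.

Everything here is proved; no definitions, no new named facts.

## References

* J. C. Lagarias, D. Montague, *The integral of the Riemann ξ-function*, Comment. Math. Univ.
  St. Pauli 60 (2011), 143–169; arXiv:1106.4348 — Lemma 3.3 (1) and its proof, p. 9.
  [key `LagariasMontague2011`]
* E. C. Titchmarsh, *The Theory of the Riemann Zeta-Function*, 2nd ed. (1986), §2.1 (2.1.12),
  Thm. 3.5, (3.5.3), §4.12 (4.12.3) (the inputs).
-/

noncomputable section

open Complex Filter Set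
open scoped Real Topology

namespace Literature.NumberTheory.LFunctions

namespace LagariasMontague

/-! ## A Stirling-order bound for `Γ` on vertical lines, sharp exponent -/

/-- **`‖Γ(x + iy)‖ ≤ K_Γ |y|^{x − 1/2} e^{−π|y|/2}`** for `−1/2 ≤ x ≤ 1`, `|y| ≥ 2`, with
`K_Γ = 2 e^{1/2} (2π)^{1/2}` (Stirling: `|Γ(x+iy)| ~ √(2π) |y|^{x−1/2} e^{−π|y|/2}`). From the tree's
`‖2(2π)^{−s'}Γ(s')cos(πs'/2)‖ ≤ e^{1/2}(|y|/2π)^{Re s' − 1/2}` at `s' = x + 1 + iy`,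
`‖cos(πs'/2)‖ ≥ sinh(π|y|/2) ≥ e^{π|y|/2}/4` and `Γ(s') = (x+iy)Γ(x+iy)`, `‖x+iy‖ ≥ |y|`.
[cite: Titchmarsh1986, §4.12 (4.12.3), consequence] -/
theorem norm_Gamma_le_rpow_mul_exp {x y : ℝ} (hx : -1 / 2 ≤ x) (hx1 : x ≤ 1) (hy : 2 ≤ |y|) :
    ‖Complex.Gamma (x + y * I)‖ ≤
      2 * Real.exp (1 / 2) * (2 * π) ^ (1 / 2 : ℝ) * |y| ^ (x - 1 / 2) *
        Real.exp (-(π * |y|) / 2) := by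
  have hπ := Real.pi_pos
  have h2π : (0 : ℝ) < 2 * π := by positivity
  have hy0 : 0 < |y| := by linarith
  set z : ℂ := (x : ℂ) + y * I with hz
  set s' : ℂ := ((x + 1 : ℝ) : ℂ) + y * I with hs'
  have hs're : s'.re = x + 1 := by simp [hs']
  have hs'im : s'.im = y := by simp [hs']
  have hzs' : s' = z + 1 := by simp only [hs', hz]; push_cast; ring
  have hz0 : z ≠ 0 := by
    intro h
    have : z.im = 0 := by rw [h]; simp
    simp [hz] at this
    rw [this, abs_zero] at hy0
    exact lt_irrefl _ hy0
  -- the functional-equation factor bound at `s'`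
  have hfe := Literature.Analysis.SpecialFunctions.GammaVert.norm_fe_factor_le_sharp (s := s')
    (by rw [hs're]; linarith) (by rw [hs're]; linarith) (by rwa [hs'im])
  rw [hs're, hs'im, show x + 1 - 1 / 2 = x + 1 / 2 by ring] at hfe
  -- norms of the factors
  have hpow : ‖(2 * (π : ℂ)) ^ (-s')‖ = (2 * π) ^ (-(x + 1)) := by
    rw [show (2 * (π : ℂ)) = ((2 * π : ℝ) : ℂ) by push_cast; ring,
      Complex.norm_cpow_eq_rpow_re_of_pos h2π]
    simp [hs']
  have hΓ : Complex.Gamma s' = z * Complex.Gamma z := by rw [hzs', Complex.Gamma_add_one _ hz0]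
  set G := ‖Complex.Gamma z‖ with hG
  set N := ‖z‖ with hN
  set c := ‖Complex.cos (π * s' / 2)‖ with hc
  have hLHS : ‖2 * (2 * (π : ℂ)) ^ (-s') * Complex.Gamma s' * Complex.cos (π * s' / 2)‖ =
      2 * (2 * π) ^ (-(x + 1)) * (N * G) * c := by
    simp only [norm_mul, Complex.norm_ofNat, hpow, hΓ, hN, hG, hc]
  rw [hLHS] at hfe
  -- lower bound for the cosine factor
  set E := Real.exp (π * |y| / 2) with hE
  have hEpos : 0 < E := Real.exp_pos _
  have hcos : E / 4 ≤ c := by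
    have h := Literature.Analysis.SpecialFunctions.abs_sinh_im_le_norm_cos (π * s' / 2)
    have him : (π * s' / 2).im = π * y / 2 := by simp [hs']
    rw [him, Real.abs_sinh, show |π * y / 2| = π * |y| / 2 by
      rw [abs_div, abs_mul, abs_of_pos hπ, abs_two]] at h
    have hs := Literature.Analysis.SpecialFunctions.exp_le_four_mul_sinh (u := π * |y| / 2)
      (by nlinarith [Real.pi_gt_three])
    rw [hc]
    linarith
  -- rpow algebra: `(2π)^{-(x+1)} = 1/((2π)^{x+1/2} (2π)^{1/2})`, `(|y|/2π)^{x+1/2} = |y|^{x+1/2}/(2π)^{x+1/2}`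
  set b := (2 * π) ^ (x + 1 / 2) with hb
  set q := (2 * π) ^ (1 / 2 : ℝ) with hq
  have hbpos : 0 < b := Real.rpow_pos_of_pos h2π _
  have hqpos : 0 < q := Real.rpow_pos_of_pos h2π _
  have hneg : (2 * π) ^ (-(x + 1)) = 1 / (b * q) := by
    rw [Real.rpow_neg h2π.le, hb, hq, ← Real.rpow_add h2π, show x + 1 / 2 + 1 / 2 = x + 1 by ring,
      one_div]
  have hdiv : (|y| / (2 * π)) ^ (x + 1 / 2) = |y| ^ (x + 1 / 2) / b := by
    rw [Real.div_rpow (abs_nonneg y) h2π.le, hb]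
  rw [hneg, hdiv] at hfe
  set Y := |y| ^ (x + 1 / 2) with hY
  have hYsplit : Y = |y| ^ (x - 1 / 2) * |y| := by
    rw [hY, show x + 1 / 2 = (x - 1 / 2) + 1 by ring, Real.rpow_add_one hy0.ne']
  -- clear denominators: `2 N G c ≤ e^{1/2} Y q`
  have hNG : 0 ≤ N * G := by positivity
  have h1 : 2 * (N * G) * c ≤ Real.exp (1 / 2) * Y * q := by
    have hbq : 0 < b * q := mul_pos hbpos hqpos
    calc 2 * (N * G) * c = (2 * (1 / (b * q)) * (N * G) * c) * (b * q) := by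
          field_simp
      _ ≤ (Real.exp (1 / 2) * (Y / b)) * (b * q) := mul_le_mul_of_nonneg_right hfe hbq.le
      _ = Real.exp (1 / 2) * Y * q := by field_simp
  -- `N G E ≤ 2 e^{1/2} q Y`
  have h2 : N * G * E ≤ 2 * Real.exp (1 / 2) * q * Y := by
    have : 2 * (N * G) * (E / 4) ≤ 2 * (N * G) * c := mul_le_mul_of_nonneg_left hcos (by positivity)
    nlinarith
  -- `|y| ≤ N`
  have hyN : |y| ≤ N := by
    have := Complex.abs_im_le_norm z
    simpa [hz] using this
  have hG0 : 0 ≤ G := norm_nonneg _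
  have h3 : G * E * |y| ≤ (2 * Real.exp (1 / 2) * q * |y| ^ (x - 1 / 2)) * |y| := by
    calc G * E * |y| ≤ G * E * N := mul_le_mul_of_nonneg_left hyN (by positivity)
      _ = N * G * E := by ring
      _ ≤ 2 * Real.exp (1 / 2) * q * Y := h2
      _ = (2 * Real.exp (1 / 2) * q * |y| ^ (x - 1 / 2)) * |y| := by rw [hYsplit]; ring
  have h4 : G * E ≤ 2 * Real.exp (1 / 2) * q * |y| ^ (x - 1 / 2) := le_of_mul_le_mul_right h3 hy0
  have hEinv : Real.exp (-(π * |y|) / 2) = E⁻¹ := by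
    rw [hE, ← Real.exp_neg]; ring_nf
  rw [hEinv, ← div_eq_mul_inv, le_div_iff₀ hEpos]
  calc G * E ≤ 2 * Real.exp (1 / 2) * q * |y| ^ (x - 1 / 2) := h4
    _ = 2 * Real.exp (1 / 2) * (2 * π) ^ (1 / 2 : ℝ) * |y| ^ (x - 1 / 2) := by rw [hq]

/-- **`Γ(s/2)` on the strip**: there is `K > 0` with
`‖Γ(s/2)‖ ≤ K |t|^{(σ−1)/2} e^{−(π/4)|t|}` for `−1 ≤ σ = Re s ≤ 2`, `|t| = |Im s| ≥ 4`
(the previous bound at `x = σ/2`, `y = t/2`, and `|t/2|^{a} = 2^{−a}|t|^{a} ≤ 2|t|^{a}` for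
`−1 ≤ a`). [cite: Titchmarsh1986, §4.12 (4.12.3), consequence] -/
theorem exists_norm_Gamma_half_le :
    ∃ K : ℝ, 0 < K ∧ ∀ s : ℂ, -1 ≤ s.re → s.re ≤ 2 → 4 ≤ |s.im| →
      ‖Complex.Gamma (s / 2)‖ ≤ K * |s.im| ^ ((s.re - 1) / 2) * Real.exp (-(π / 4) * |s.im|) := by
  refine ⟨2 * (2 * Real.exp (1 / 2) * (2 * π) ^ (1 / 2 : ℝ)), by positivity, ?_⟩
  intro s hσ hσ2 ht
  set σ := s.re with hσdef
  set t := s.im with htdef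
  have ht0 : 0 < |t| := by linarith
  have hs : s / 2 = ((σ / 2 : ℝ) : ℂ) + ((t / 2 : ℝ) : ℂ) * I := by
    apply Complex.ext <;> simp [hσdef, htdef]
  have habs : |t / 2| = |t| / 2 := by rw [abs_div, abs_two]
  have h := norm_Gamma_le_rpow_mul_exp (x := σ / 2) (y := t / 2) (by linarith) (by linarith)
    (by rw [habs]; linarith)
  rw [← hs, habs] at h
  refine h.trans ?_
  have hexp : Real.exp (-(π * (|t| / 2)) / 2) = Real.exp (-(π / 4) * |t|) := by ring_nf
  have hrpow : (|t| / 2) ^ (σ / 2 - 1 / 2) ≤ 2 * |t| ^ ((σ - 1) / 2) := by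
    rw [show σ / 2 - 1 / 2 = (σ - 1) / 2 by ring, Real.div_rpow (abs_nonneg t) zero_le_two,
      div_eq_mul_inv, ← Real.rpow_neg zero_le_two, mul_comm]
    refine mul_le_mul_of_nonneg_right ?_ (by positivity)
    calc (2 : ℝ) ^ (-((σ - 1) / 2)) ≤ 2 ^ (1 : ℝ) :=
          Real.rpow_le_rpow_of_exponent_le (by norm_num) (by linarith)
      _ = 2 := Real.rpow_one 2
  rw [hexp]
  have hK : 0 ≤ 2 * Real.exp (1 / 2) * (2 * π) ^ (1 / 2 : ℝ) := by positivity
  have hE := Real.exp_pos (-(π / 4) * |t|)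
  calc 2 * Real.exp (1 / 2) * (2 * π) ^ (1 / 2 : ℝ) * (|t| / 2) ^ (σ / 2 - 1 / 2) *
        Real.exp (-(π / 4) * |t|)
      ≤ 2 * Real.exp (1 / 2) * (2 * π) ^ (1 / 2 : ℝ) * (2 * |t| ^ ((σ - 1) / 2)) *
        Real.exp (-(π / 4) * |t|) := by gcongr
    _ = _ := by ring

/-! ## `ζ` on the strip, weighted by the Stirling exponent of `Γ(s/2)` -/

/-- `log|t| ≤ 4|t|^{1/4}` and `1 ≤ |t|^{1/4}` for `|t| ≥ 1`. [folklore] -/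
theorem log_le_four_mul_rpow_quarter {u : ℝ} (hu : 1 ≤ u) :
    Real.log u ≤ 4 * u ^ (1 / 4 : ℝ) ∧ 1 ≤ u ^ (1 / 4 : ℝ) := by
  refine ⟨?_, Real.one_le_rpow hu (by norm_num)⟩
  have h := Real.log_le_rpow_div (by linarith : (0 : ℝ) ≤ u) (by norm_num : (0 : ℝ) < 1 / 4)
  linarith [show u ^ (1 / 4 : ℝ) / (1 / 4) = 4 * u ^ (1 / 4 : ℝ) by ring]

/-- **`|t|^{(σ−1)/2} ‖ζ(σ + it)‖ ≤ 84 |t|^{1/2}` for `1/2 ≤ σ ≤ 2`, `|t| ≥ 3`.** Three regimes: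
`‖ζ‖ ≤ 10|t|^{1−σ}(1+log|t|)` on `σ ≤ 1` (Titchmarsh (3.5.3)), `‖ζ‖ ≤ 21 log|t|` on `1 ≤ σ ≤ 3/2`
(Titchmarsh Thm. 3.5) and `‖ζ‖ ≤ σ/(σ−1) ≤ 3` on `σ ≥ 3/2`, with `log|t| ≤ 4|t|^{1/4}`.
[cite: Titchmarsh1986, Thm. 3.5 and (3.5.3), consequence] -/
theorem rpow_mul_norm_zeta_le {s : ℂ} (hσ : 1 / 2 ≤ s.re) (hσ2 : s.re ≤ 2) (ht : 3 ≤ |s.im|) :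
    |s.im| ^ ((s.re - 1) / 2) * ‖riemannZeta s‖ ≤ 84 * |s.im| ^ (1 / 2 : ℝ) := by
  set σ := s.re with hσdef
  set t := s.im with htdef
  have ht1 : 1 ≤ |t| := by linarith
  obtain ⟨hlog, hone⟩ := log_le_four_mul_rpow_quarter ht1
  have hlog0 : 0 < Real.log |t| := Real.log_pos (by linarith)
  have hq0 : 0 ≤ |t| ^ (1 / 4 : ℝ) := by positivity
  have hqq : |t| ^ (1 / 4 : ℝ) * |t| ^ (1 / 4 : ℝ) = |t| ^ (1 / 2 : ℝ) := by
    rw [← Real.rpow_add (by linarith)]; norm_num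
  rcases le_or_gt σ 1 with h1 | h1
  · -- `1/2 ≤ σ ≤ 1`
    have hζ := HuxleyLV.norm_zeta_le_rpow_log (s := s) hσ h1 ht
    have hpow : |t| ^ ((σ - 1) / 2) * |t| ^ (1 - σ) = |t| ^ ((1 - σ) / 2) := by
      rw [← Real.rpow_add (by linarith)]; ring_nf
    have hle : |t| ^ ((1 - σ) / 2) ≤ |t| ^ (1 / 4 : ℝ) :=
      Real.rpow_le_rpow_of_exponent_le ht1 (by linarith)
    calc |t| ^ ((σ - 1) / 2) * ‖riemannZeta s‖
        ≤ |t| ^ ((σ - 1) / 2) * (10 * |t| ^ (1 - σ) * (1 + Real.log |t|)) :=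
          mul_le_mul_of_nonneg_left hζ (by positivity)
      _ = 10 * (|t| ^ ((σ - 1) / 2) * |t| ^ (1 - σ)) * (1 + Real.log |t|) := by ring
      _ = 10 * |t| ^ ((1 - σ) / 2) * (1 + Real.log |t|) := by rw [hpow]
      _ ≤ 10 * |t| ^ (1 / 4 : ℝ) * (5 * |t| ^ (1 / 4 : ℝ)) := by gcongr; linarith
      _ = 50 * |t| ^ (1 / 2 : ℝ) := by rw [← hqq]; ring
      _ ≤ 84 * |t| ^ (1 / 2 : ℝ) := by gcongr; norm_num
  rcases le_or_gt σ (3 / 2) with h2 | h2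
  · -- `1 < σ ≤ 3/2`
    have hζ := ZetaOneLine.norm_riemannZeta_le_log (s := s) ht
      (by have : 0 < 1 / (2 * Real.log |t|) := by positivity
          linarith)
    have hle : |t| ^ ((σ - 1) / 2) ≤ |t| ^ (1 / 4 : ℝ) :=
      Real.rpow_le_rpow_of_exponent_le ht1 (by linarith)
    calc |t| ^ ((σ - 1) / 2) * ‖riemannZeta s‖
        ≤ |t| ^ (1 / 4 : ℝ) * (21 * Real.log |t|) :=
          mul_le_mul hle hζ (norm_nonneg _) hq0
      _ ≤ |t| ^ (1 / 4 : ℝ) * (21 * (4 * |t| ^ (1 / 4 : ℝ))) := by gcongr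
      _ = 84 * |t| ^ (1 / 2 : ℝ) := by rw [← hqq]; ring
  · -- `3/2 < σ ≤ 2`
    have hζ : ‖riemannZeta s‖ ≤ 3 := by
      refine (ZetaClassicalRegion.norm_riemannZeta_le_of_one_lt_re (s := s) (by linarith)).trans ?_
      rw [div_le_iff₀ (by linarith)]; linarith
    have hle : |t| ^ ((σ - 1) / 2) ≤ |t| ^ (1 / 2 : ℝ) :=
      Real.rpow_le_rpow_of_exponent_le ht1 (by linarith)
    calc |t| ^ ((σ - 1) / 2) * ‖riemannZeta s‖ ≤ |t| ^ (1 / 2 : ℝ) * 3 :=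
          mul_le_mul hle hζ (norm_nonneg _) (by positivity)
      _ ≤ 84 * |t| ^ (1 / 2 : ℝ) := by nlinarith [Real.rpow_nonneg (abs_nonneg t) (1 / 2 : ℝ)]

/-! ## `ξ = ½ s(s−1) π^{−s/2} Γ(s/2) ζ(s)` in norm -/

/-- `‖ξ(s)‖ ≤ ‖s‖ ‖s − 1‖ / 2 · ‖Γ(s/2)‖ · ‖ζ(s)‖` for `Re s > 0`, `s ≠ 1`
(`ξ = ½ s(s−1) π^{−s/2}Γ(s/2)ζ(s)` and `‖π^{−s/2}‖ = π^{−σ/2} ≤ 1`).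
[cite: Titchmarsh1986, §2.1 (2.1.12), consequence] -/
theorem norm_riemannXi_le_prod {s : ℂ} (hs : 0 < s.re) (hs1 : s ≠ 1) :
    ‖riemannXi s‖ ≤ ‖s‖ * ‖s - 1‖ / 2 * ‖Complex.Gamma (s / 2)‖ * ‖riemannZeta s‖ := by
  have hs0 : s ≠ 0 := fun h ↦ by rw [h, Complex.zero_re] at hs; exact lt_irrefl _ hs
  have hΓℝ : Gammaℝ s ≠ 0 := Gammaℝ_ne_zero_of_re_pos hs
  have hΛ : completedRiemannZeta s = Gammaℝ s * riemannZeta s := by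
    rw [riemannZeta_def_of_ne_zero hs0]; field_simp
  have hπ : ‖(π : ℂ) ^ (-s / 2)‖ ≤ 1 := by
    rw [Complex.norm_cpow_eq_rpow_re_of_pos Real.pi_pos]
    refine Real.rpow_le_one_of_one_le_of_nonpos (by linarith [Real.pi_gt_three]) ?_
    have hre : (-s / 2).re = -s.re / 2 := by simp
    rw [hre]
    linarith
  rw [riemannXi_eq_mul_completedRiemannZeta hs0 hs1, hΛ, Gammaℝ_def]
  simp only [norm_mul, norm_div, Complex.norm_ofNat]
  have h0 : 0 ≤ ‖s‖ * ‖s - 1‖ / 2 * ‖Complex.Gamma (s / 2)‖ * ‖riemannZeta s‖ := by positivity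
  calc ‖s‖ * ‖s - 1‖ / 2 * (‖(π : ℂ) ^ (-s / 2)‖ * ‖Complex.Gamma (s / 2)‖ * ‖riemannZeta s‖)
      = ‖(π : ℂ) ^ (-s / 2)‖ * (‖s‖ * ‖s - 1‖ / 2 * ‖Complex.Gamma (s / 2)‖ * ‖riemannZeta s‖) := by
        ring
    _ ≤ 1 * (‖s‖ * ‖s - 1‖ / 2 * ‖Complex.Gamma (s / 2)‖ * ‖riemannZeta s‖) :=
        mul_le_mul_of_nonneg_right hπ h0
    _ = _ := one_mul _

/-! ## Assembly -/

/-- **Large height**: there is `C > 0` with `‖ξ(s)‖ ≤ C e^{−(π/4)|t|} (|t|+1)^{5/2}` for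
`1/2 ≤ Re s ≤ 2`, `|t| ≥ 6`. [cite: LagariasMontague2011, Lemma 3.3 (1), proof] -/
theorem exists_norm_riemannXi_le_of_large_im :
    ∃ C : ℝ, 0 < C ∧ ∀ s : ℂ, 1 / 2 ≤ s.re → s.re ≤ 2 → 6 ≤ |s.im| →
      ‖riemannXi s‖ ≤ C * Real.exp (-(π / 4) * |s.im|) * (|s.im| + 1) ^ (5 / 2 : ℝ) := by
  obtain ⟨K, hK, hΓ⟩ := exists_norm_Gamma_half_le
  refine ⟨84 * K, by positivity, ?_⟩
  intro s hσ hσ2 ht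
  set σ := s.re with hσdef
  set t := s.im with htdef
  have ht0 : 0 ≤ |t| := abs_nonneg t
  have hs1 : s ≠ 1 := by
    intro h
    have : t = 0 := by rw [htdef, h]; simp
    rw [this, abs_zero] at ht
    linarith
  have hprod := norm_riemannXi_le_prod (s := s) (by linarith) hs1
  have hG := hΓ s (by linarith) hσ2 (by linarith)
  have hZ := rpow_mul_norm_zeta_le (s := s) hσ hσ2 (by linarith)
  -- `‖s‖ ≤ 2(|t|+1)`, `‖s-1‖ ≤ |t|+1`
  have hns : ‖s‖ ≤ 2 * (|t| + 1) := by
    have h := Complex.norm_le_abs_re_add_abs_im s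
    have : |s.re| ≤ 2 := by rw [abs_le]; constructor <;> linarith
    rw [← htdef] at h
    linarith
  have hns1 : ‖s - 1‖ ≤ |t| + 1 := by
    have h := Complex.norm_le_abs_re_add_abs_im (s - 1)
    have e1 : (s - 1).re = σ - 1 := by simp [hσdef]
    have e2 : (s - 1).im = t := by simp [htdef]
    have : |σ - 1| ≤ 1 := by rw [abs_le]; constructor <;> linarith
    rw [e1, e2] at h
    linarith
  have hE := Real.exp_pos (-(π / 4) * |t|)
  -- `(|t|+1)^{5/2} = (|t|+1)² (|t|+1)^{1/2}` and `|t|^{1/2} ≤ (|t|+1)^{1/2}`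
  have h52 : (|t| + 1) ^ (5 / 2 : ℝ) = (|t| + 1) ^ 2 * (|t| + 1) ^ (1 / 2 : ℝ) := by
    rw [show (5 / 2 : ℝ) = 2 + 1 / 2 by norm_num, Real.rpow_add (by linarith), Real.rpow_two]
  have hhalf : |t| ^ (1 / 2 : ℝ) ≤ (|t| + 1) ^ (1 / 2 : ℝ) :=
    Real.rpow_le_rpow ht0 (by linarith) (by norm_num)
  calc ‖riemannXi s‖
      ≤ ‖s‖ * ‖s - 1‖ / 2 * ‖Complex.Gamma (s / 2)‖ * ‖riemannZeta s‖ := hprod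
    _ ≤ (2 * (|t| + 1)) * (|t| + 1) / 2 *
          (K * |t| ^ ((σ - 1) / 2) * Real.exp (-(π / 4) * |t|)) * ‖riemannZeta s‖ := by
        gcongr
    _ = K * Real.exp (-(π / 4) * |t|) * (|t| + 1) ^ 2 *
          (|t| ^ ((σ - 1) / 2) * ‖riemannZeta s‖) := by ring
    _ ≤ K * Real.exp (-(π / 4) * |t|) * (|t| + 1) ^ 2 * (84 * (|t| + 1) ^ (1 / 2 : ℝ)) :=
        mul_le_mul_of_nonneg_left (hZ.trans (mul_le_mul_of_nonneg_left hhalf (by norm_num)))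
          (by positivity)
    _ = 84 * K * Real.exp (-(π / 4) * |t|) * (|t| + 1) ^ (5 / 2 : ℝ) := by rw [h52]; ring

/-- **Bounded height**: there is `C > 0` with `‖ξ(s)‖ ≤ C e^{−(π/4)|t|} (|t|+1)^{5/2}` for
`1/2 ≤ Re s ≤ 2`, `|t| ≤ 6` (`ξ` is entire, hence bounded on the compact rectangle
`[1/2, 2] × [−6, 6]`). [folklore] -/
theorem exists_norm_riemannXi_le_of_small_im :
    ∃ C : ℝ, 0 < C ∧ ∀ s : ℂ, 1 / 2 ≤ s.re → s.re ≤ 2 → |s.im| ≤ 6 →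
      ‖riemannXi s‖ ≤ C * Real.exp (-(π / 4) * |s.im|) * (|s.im| + 1) ^ (5 / 2 : ℝ) := by
  have hK : IsCompact (Icc (1 / 2 : ℝ) 2 ×ℂ Icc (-6 : ℝ) 6) := isCompact_Icc.reProdIm isCompact_Icc
  obtain ⟨M, hM⟩ := hK.exists_bound_of_continuousOn
    (differentiable_riemannXi.continuous.continuousOn)
  refine ⟨(max M 0 + 1) * Real.exp (π / 4 * 6), by positivity, ?_⟩
  intro s hσ hσ2 ht
  have hmem : s ∈ (Icc (1 / 2 : ℝ) 2 ×ℂ Icc (-6 : ℝ) 6) :=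
    Complex.mem_reProdIm.2 ⟨⟨hσ, hσ2⟩, abs_le.1 ht⟩
  have h1 := hM s hmem
  have hM0 : M ≤ max M 0 + 1 := by linarith [le_max_left M 0]
  have hexp : 1 ≤ Real.exp (π / 4 * 6) * Real.exp (-(π / 4) * |s.im|) := by
    rw [← Real.exp_add]
    exact Real.one_le_exp (by nlinarith [Real.pi_pos, abs_nonneg s.im])
  have hpow : 1 ≤ (|s.im| + 1) ^ (5 / 2 : ℝ) :=
    Real.one_le_rpow (by linarith [abs_nonneg s.im]) (by norm_num)
  have hpos : 0 ≤ max M 0 + 1 := by positivity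
  calc ‖riemannXi s‖ ≤ max M 0 + 1 := h1.trans hM0
    _ = (max M 0 + 1) * 1 * 1 := by ring
    _ ≤ (max M 0 + 1) * (Real.exp (π / 4 * 6) * Real.exp (-(π / 4) * |s.im|)) *
          (|s.im| + 1) ^ (5 / 2 : ℝ) := by gcongr
    _ = (max M 0 + 1) * Real.exp (π / 4 * 6) * Real.exp (-(π / 4) * |s.im|) *
          (|s.im| + 1) ^ (5 / 2 : ℝ) := by ring

end LagariasMontague

/-- **Lagarias–Montague 2011, Lemma 3.3 (1)** (discharge of the named fact
`norm_riemannXi_le_of_mem_strip_LM`): there is `C₁ > 0` such that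
`|ξ(s)| ≤ C₁ e^{−π|t|/4} (|t| + 1)^{5/2}` for `1/2 ≤ Re s ≤ 2`. Proof as printed (p. 9:
`|½s(s−1)| = O(|t|²)`, `|π^{−s/2}| = O(1)`, Stirling for `Γ(s/2)`, convexity-type bounds for `ζ`),
with the balance of exponents `|Γ(s/2)| ≪ |t|^{(σ−1)/2}e^{−π|t|/4}`, `|t|^{(σ−1)/2}|ζ(s)| ≪ |t|^{1/2}`
made explicit (the printed `|Γ(s/2)| = O(e^{−π|t|/4})` holds only for `σ ≤ 1`; the exponent `5/2`
is attained at `σ = 2`). [cite: LagariasMontague2011, Lemma 3.3 (1)] -/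
theorem norm_riemannXi_le_of_mem_strip_LM_holds : norm_riemannXi_le_of_mem_strip_LM := by
  obtain ⟨C, hC, hlarge⟩ := LagariasMontague.exists_norm_riemannXi_le_of_large_im
  obtain ⟨C', hC', hsmall⟩ := LagariasMontague.exists_norm_riemannXi_le_of_small_im
  refine ⟨C + C', by positivity, fun s hσ hσ2 ↦ ?_⟩
  have hF : 0 ≤ Real.exp (-(π / 4) * |s.im|) * (|s.im| + 1) ^ (5 / 2 : ℝ) := by positivity
  rcases le_or_gt 6 |s.im| with ht | ht
  · calc ‖riemannXi s‖ ≤ C * Real.exp (-(π / 4) * |s.im|) * (|s.im| + 1) ^ (5 / 2 : ℝ) :=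
          hlarge s hσ hσ2 ht
      _ ≤ (C + C') * Real.exp (-(π / 4) * |s.im|) * (|s.im| + 1) ^ (5 / 2 : ℝ) := by
          rw [mul_assoc, mul_assoc]; exact mul_le_mul_of_nonneg_right (by linarith) hF
  · calc ‖riemannXi s‖ ≤ C' * Real.exp (-(π / 4) * |s.im|) * (|s.im| + 1) ^ (5 / 2 : ℝ) :=
          hsmall s hσ hσ2 ht.le
      _ ≤ (C + C') * Real.exp (-(π / 4) * |s.im|) * (|s.im| + 1) ^ (5 / 2 : ℝ) := by
          rw [mul_assoc, mul_assoc]; exact mul_le_mul_of_nonneg_right (by linarith) hF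

end Literature.NumberTheory.LFunctions

end
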